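import Mathlib
import HarnessLib
import Summits.Ventures.LatticeQCDFlow.Exactness.SUNMultiStepLeapfrogHMCErgodic
import Summits.Ventures.LatticeQCDFlow.Exactness.SUNLeapfrogHMCWilson

/-!
# The engine's multi-step `SU(N)` HMC is uniformly ergodic for short trajectories: the engine's coordinates, kinetic term and the Wilson action

HONEST FRAMING: exact (Metropolis-corrected) sampling algorithms for lattice gauge theory;
figures of merit are autocorrelation/cost numbers at stated couplings and volumes; no
continuum-physics claim.

Venture `LatticeQCDFlow` (cell pub-lqcd), topic `Exactness`, FANOUT row 9 (eng-latcore, the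
engine `latflow.core.hmc.HMC(f, β, 'leapfrog').trajectory(τ, nstep)` (4D) and `sun_2d.HMC2D` (2D) on
`SU(N)`: momenta `P = i(H − tr H/N)` from `sun.random_algebra`, kinetic term `−tr P²`, `nstep` P-first
leapfrog steps `U ← expm(εP) U`, Metropolis test).  NEW WORK of the cell over the tree
(`SUNMultiStepLeapfrogHMCErgodic.lean`: uniform ergodicity for any coordinates / additive Haar measure /
kinetic term bounded on boxes with `Z_T < ∞`; `SUNLeapfrogHMCEngine.lean`: the engine's coordinates
`sunCoordι` — injective, onto, skew-Hermitian traceless — and `Z_T < ∞` for `sunKinetic`;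
`SUNLeapfrogHMCWilson.lean`: `β S_W` is bounded and its Gibbs law is the Literature Wilson measure);
nothing here is cited as a fact.  The Wilson action and measure are the Literature definitions of
`ConstructiveQFTWave0`, used by name.

* **`engine_sunLeapfrogHMCN_uniformlyErgodic`** / **`engine_sunLeapfrogHMCN_invariant_unique`** — for
  every `N ≥ 1`, every finite link set, `n ≥ 1` steps of size `ε > 0`, every measurable momentum
  increment bounded by `b ≥ 0` per link and `K_g`-Lipschitz in the matrix sup norm, every measurable
  action bounded by `s`: IF `nε ≤ s_N`, `(2n+1)b ≤ s_N`, `K_g εn² ≤ s_N` with the positive threshold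
  `s_N = sunShortTrajThreshold (sunCoordι N) _` of the engine's coordinates, the engine's `n`-step leapfrog
  HMC kernel `sunLeapfrogHMCN (sunCoordι N) _ ε addHaar (sunKinetic N) hg S n` converges to
  `Z_S⁻¹e^{−S}·Haar^{⊗links}` from EVERY initial law geometrically in total variation, and that law is its
  unique invariant probability law.
* **`wilson_sunLeapfrogHMCN_uniformlyErgodic`** / **`wilsonMeasure_unique_invariant_sunLeapfrogHMCN`** —
  the same for the `SU(N)` Wilson action `β S_W` of the torus `(ℤ/L)^d` (continuous representation, any
  real `β`): convergence to `wilsonMeasure ρ β`.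
* **`engine_sunLeapfrogHMCN_uniformlyErgodic_of_trajLength`** — trajectory-length form: for a measurable
  force field `F` bounded by `F_max` and `K_F`-Lipschitz there is `τ₀ > 0` (coordinates, `F_max`, `K_F`
  only) such that EVERY `n ≥ 1`, `ε > 0` with `nε ≤ τ₀` gives a uniformly ergodic exact chain with the
  half kick `−(ε/2)·F`.

NOT CLAIMED: anything beyond the threshold (the engine's usual `τ = nε ≈ 1` is NOT covered; long
fixed-length trajectories can be non-ergodic, Mackenzie 1989); any usable value of `s_N`; that the
engine's force routine `−½ε∂(βS_W)` is Lipschitz with a stated constant (it is a polynomial map on a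
compact set, but the constant is not derived here — the statement covers ANY bounded Lipschitz
increment); OMF words / `tau_jitter`; floating point.
-/

noncomputable section

namespace Summit.Ventures.LatticeQCDFlow.Exactness

open MeasureTheory ProbabilityTheory ProbabilityTheory.Kernel Set Metric Function
open Literature.MathematicalPhysics.QuantumFieldTheory
open scoped ENNReal Matrix Matrix.Norms.Operator NNReal

/-! ## §1 The engine's coordinates and kinetic term -/

section Engine

variable (N : ℕ) [NeZero N] {L : Type*} [Fintype L] {ε : ℝ} {nstep : ℕ}
  {g : (L → Matrix.specialUnitaryGroup (Fin N) ℂ) → L → SUNCoords N}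
  {S : (L → Matrix.specialUnitaryGroup (Fin N) ℂ) → ℝ} {b Kg s : ℝ}

/-- **THE ENGINE'S `n`-STEP LEAPFROG HMC ON `SU(N)^links` IS UNIFORMLY ERGODIC FOR SHORT TRAJECTORIES.**
`N ≥ 1`, finite link set, `n ≥ 1` steps of size `ε > 0`, a measurable increment bounded by `b ≥ 0`
per link and `K_g`-Lipschitz (`K_g ≥ 0`) in the matrix sup norm, a measurable action bounded by `s`,
and `nε, (2n+1)b, K_g εn² ≤ s_N`: with the engine's coordinates `sunCoordι N`, kinetic term
`sunKinetic N = −Σ tr P²` and Gaussian refresh `Z⁻¹e^{−T}·addHaar^⊗`, there are `k` and `δ ∈ (0, 1]` with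
`|μ₀Kᵗ(A) − π_S(A)| ≤ (1 − δ)^{⌊t/(k+1)⌋}` for EVERY initial law, `π_S = Z_S⁻¹e^{−S}·Haar^{⊗links}`. -/
theorem engine_sunLeapfrogHMCN_uniformlyErgodic (hε : 0 < ε) (hn : 1 ≤ nstep) (hg : Measurable g)
    (hb0 : 0 ≤ b) (hb : ∀ u l, ‖g u l‖ ≤ b) (hK0 : 0 ≤ Kg)
    (hK : ∀ U U', ‖g U - g U'‖ ≤ Kg * ‖coeConfig U - coeConfig U'‖) (hS : Measurable S) (hs : ∀ u, |S u| ≤ s)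
    (h1 : nstep * ε ≤ sunShortTrajThreshold (sunCoordι N) (sunCoordι_injective N))
    (h2 : (2 * nstep + 1) * b ≤ sunShortTrajThreshold (sunCoordι N) (sunCoordι_injective N))
    (h3 : Kg * ε * (nstep : ℝ) ^ 2 ≤ sunShortTrajThreshold (sunCoordι N) (sunCoordι_injective N)) :
    ∃ k : ℕ, ∃ δ : ℝ, 0 < δ ∧ δ ≤ 1 ∧ ∀ (μ₀ : Measure (L → Matrix.specialUnitaryGroup (Fin N) ℂ))
      [IsProbabilityMeasure μ₀] (t : ℕ) (A : Set (L → Matrix.specialUnitaryGroup (Fin N) ℂ)),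
      |((fun m : Measure (L → Matrix.specialUnitaryGroup (Fin N) ℂ) =>
            m.bind (sunLeapfrogHMCN (sunCoordι N) (sunCoordι_skew N) ε (Measure.addHaar : Measure (SUNCoords N))
              (sunKinetic N) hg S nstep))^[t] μ₀).real A
          - (gibbsProbability (Measure.pi fun _ : L => haarProbability (Matrix.specialUnitaryGroup (Fin N) ℂ))
              (fun u => Real.exp (-S u))).real A| ≤ (1 - δ) ^ (t / (k + 1)) :=
  sunLeapfrogHMCN_uniformlyErgodic (sunCoordι N) (sunCoordι_skew N) (sunCoordι_injective N) Measure.addHaar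
    (τ := fun R => Fintype.card L * ((N + 4 * Fintype.card (UpperPair N)) * R ^ 2))
    (sunCoordι_range N) hε hn (measurable_sunKinetic N) (sunKinetic_nonneg N)
    (sunKinetic_le_of_norm_le N) (sunMomentumWeight_sunKinetic_ne_top N Measure.addHaar) hg hb0 hb hK0 hK hS hs h1 h2 h3

/-- **… and `Z_S⁻¹e^{−S}·Haar^{⊗links}` is its ONLY invariant probability law.** -/
theorem engine_sunLeapfrogHMCN_invariant_unique (hε : 0 < ε) (hn : 1 ≤ nstep) (hg : Measurable g)
    (hb0 : 0 ≤ b) (hb : ∀ u l, ‖g u l‖ ≤ b) (hK0 : 0 ≤ Kg)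
    (hK : ∀ U U', ‖g U - g U'‖ ≤ Kg * ‖coeConfig U - coeConfig U'‖) (hS : Measurable S) (hs : ∀ u, |S u| ≤ s)
    (h1 : nstep * ε ≤ sunShortTrajThreshold (sunCoordι N) (sunCoordι_injective N))
    (h2 : (2 * nstep + 1) * b ≤ sunShortTrajThreshold (sunCoordι N) (sunCoordι_injective N))
    (h3 : Kg * ε * (nstep : ℝ) ^ 2 ≤ sunShortTrajThreshold (sunCoordι N) (sunCoordι_injective N))
    {π' : Measure (L → Matrix.specialUnitaryGroup (Fin N) ℂ)} [IsProbabilityMeasure π']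
    (hπ' : Invariant (sunLeapfrogHMCN (sunCoordι N) (sunCoordι_skew N) ε (Measure.addHaar : Measure (SUNCoords N))
      (sunKinetic N) hg S nstep) π') :
    π' = gibbsProbability (Measure.pi fun _ : L => haarProbability (Matrix.specialUnitaryGroup (Fin N) ℂ))
      (fun u => Real.exp (-S u)) :=
  sunLeapfrogHMCN_invariant_unique (sunCoordι N) (sunCoordι_skew N) (sunCoordι_injective N) Measure.addHaar
    (τ := fun R => Fintype.card L * ((N + 4 * Fintype.card (UpperPair N)) * R ^ 2))
    (sunCoordι_range N) hε hn (measurable_sunKinetic N) (sunKinetic_nonneg N)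
    (sunKinetic_le_of_norm_le N) (sunMomentumWeight_sunKinetic_ne_top N Measure.addHaar) hg hb0 hb hK0 hK hS hs h1 h2 h3 hπ'

end Engine

/-! ## §2 The Wilson action -/

section Wilson

variable (N : ℕ) [NeZero N] {d L M : ℕ} (ρ : Matrix.specialUnitaryGroup (Fin N) ℂ →* Matrix (Fin M) (Fin M) ℂ)
  {ε : ℝ} {nstep : ℕ} {b Kg : ℝ}

/-- **THE ENGINE'S `n`-STEP LEAPFROG HMC CONVERGES TO THE `SU(N)` WILSON MEASURE FROM EVERY START, FOR
SHORT TRAJECTORIES.**  Torus `(ℤ/L)^d`, `G = SU(N)`, continuous representation `ρ`, any real `β`;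
`n ≥ 1` P-first leapfrog steps of size `ε > 0`, the engine's momenta / kinetic term, ANY measurable
momentum increment bounded by `b ≥ 0` per link and `K_g`-Lipschitz in the matrix sup norm, Metropolis
test on `β S_W + T`; IF `nε, (2n+1)b, K_g εn² ≤ s_N`: there are `k` and `δ ∈ (0, 1]` with
`|μ₀Kᵗ(A) − wilsonMeasure ρ β (A)| ≤ (1 − δ)^{⌊t/(k+1)⌋}` for EVERY initial law `μ₀`, every `t`, `A`. -/
theorem wilson_sunLeapfrogHMCN_uniformlyErgodic [NeZero L] (hρ : Continuous ρ) (β : ℝ) (hε : 0 < ε) (hn : 1 ≤ nstep)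
    {g : GaugeConfig d L (Matrix.specialUnitaryGroup (Fin N) ℂ) → Edge d L → SUNCoords N}
    (hg : Measurable g) (hb0 : 0 ≤ b) (hb : ∀ U e, ‖g U e‖ ≤ b) (hK0 : 0 ≤ Kg)
    (hK : ∀ U U', ‖g U - g U'‖ ≤ Kg * ‖coeConfig U - coeConfig U'‖)
    (h1 : nstep * ε ≤ sunShortTrajThreshold (sunCoordι N) (sunCoordι_injective N))
    (h2 : (2 * nstep + 1) * b ≤ sunShortTrajThreshold (sunCoordι N) (sunCoordι_injective N))
    (h3 : Kg * ε * (nstep : ℝ) ^ 2 ≤ sunShortTrajThreshold (sunCoordι N) (sunCoordι_injective N)) :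
    ∃ k : ℕ, ∃ δ : ℝ, 0 < δ ∧ δ ≤ 1 ∧
      ∀ (μ₀ : Measure (GaugeConfig d L (Matrix.specialUnitaryGroup (Fin N) ℂ))) [IsProbabilityMeasure μ₀]
        (t : ℕ) (A : Set (GaugeConfig d L (Matrix.specialUnitaryGroup (Fin N) ℂ))),
        |((fun m : Measure (GaugeConfig d L (Matrix.specialUnitaryGroup (Fin N) ℂ)) =>
              m.bind (sunLeapfrogHMCN (sunCoordι N) (sunCoordι_skew N) ε (Measure.addHaar : Measure (SUNCoords N))
                (sunKinetic N) hg (fun U => β * wilsonAction ρ U) nstep))^[t] μ₀).real A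
            - (wilsonMeasure (d := d) (L := L) ρ β).real A| ≤ (1 - δ) ^ (t / (k + 1)) := by
  obtain ⟨s, hs⟩ := exists_bound_smul_wilsonAction_sun N (d := d) (L := L) ρ hρ β
  rw [← gibbsProbability_smul_wilsonAction_eq N (d := d) (L := L) ρ β]
  exact engine_sunLeapfrogHMCN_uniformlyErgodic N hε hn hg hb0 hb hK0 hK
    (continuous_smul_wilsonAction ρ hρ β).measurable hs h1 h2 h3

/-- **The Wilson measure is the unique invariant probability law of the engine's `n`-step leapfrog HMC**
on `SU(N)` lattice gauge fields, for short trajectories (same hypotheses). -/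
theorem wilsonMeasure_unique_invariant_sunLeapfrogHMCN [NeZero L] (hρ : Continuous ρ) (β : ℝ) (hε : 0 < ε)
    (hn : 1 ≤ nstep) {g : GaugeConfig d L (Matrix.specialUnitaryGroup (Fin N) ℂ) → Edge d L → SUNCoords N}
    (hg : Measurable g) (hb0 : 0 ≤ b) (hb : ∀ U e, ‖g U e‖ ≤ b) (hK0 : 0 ≤ Kg)
    (hK : ∀ U U', ‖g U - g U'‖ ≤ Kg * ‖coeConfig U - coeConfig U'‖)
    (h1 : nstep * ε ≤ sunShortTrajThreshold (sunCoordι N) (sunCoordι_injective N))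
    (h2 : (2 * nstep + 1) * b ≤ sunShortTrajThreshold (sunCoordι N) (sunCoordι_injective N))
    (h3 : Kg * ε * (nstep : ℝ) ^ 2 ≤ sunShortTrajThreshold (sunCoordι N) (sunCoordι_injective N))
    {π' : Measure (GaugeConfig d L (Matrix.specialUnitaryGroup (Fin N) ℂ))} [IsProbabilityMeasure π']
    (hπ' : Invariant (sunLeapfrogHMCN (sunCoordι N) (sunCoordι_skew N) ε (Measure.addHaar : Measure (SUNCoords N))
      (sunKinetic N) hg (fun U => β * wilsonAction ρ U) nstep) π') :
    π' = wilsonMeasure (d := d) (L := L) ρ β := by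
  obtain ⟨s, hs⟩ := exists_bound_smul_wilsonAction_sun N (d := d) (L := L) ρ hρ β
  rw [← gibbsProbability_smul_wilsonAction_eq N (d := d) (L := L) ρ β]
  exact engine_sunLeapfrogHMCN_invariant_unique N hε hn hg hb0 hb hK0 hK
    (continuous_smul_wilsonAction ρ hρ β).measurable hs h1 h2 h3 hπ'

end Wilson

/-! ## §3 In trajectory-length form: a force field `F` and the increment `−(ε/2)·F` -/

section Force

variable (N : ℕ) [NeZero N] {L : Type*} [Fintype L]
  {F : (L → Matrix.specialUnitaryGroup (Fin N) ℂ) → L → SUNCoords N}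
  {S : (L → Matrix.specialUnitaryGroup (Fin N) ℂ) → ℝ} {Fmax KF s : ℝ}

omit [NeZero N] [Fintype L] in
/-- The half kick `−(ε/2)·F` is measurable. -/
theorem measurable_halfKick_sun (hF : Measurable F) (ε : ℝ) :
    Measurable fun U : L → Matrix.specialUnitaryGroup (Fin N) ℂ => (-(ε / 2)) • F U :=
  measurable_pi_lambda _ fun l =>
    (continuous_const_smul (-(ε / 2))).measurable.comp ((measurable_pi_apply l).comp hF)

/-- Arithmetic of the trajectory-length threshold: with
`τ₀ = min s₀ (min (s₀/(3F+1)) √(s₀/(K+1)))` and `nε ≤ τ₀` (`n ≥ 1`, `ε > 0`, `F, K ≥ 0`, `0 < s₀ ≤ 1`):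
`nε ≤ s₀`, `(2n+1)·(ε/2)F ≤ s₀`, `((ε/2)K)·ε·n² ≤ s₀`. -/
theorem trajLength_threshold_arith {s₀ Fm K ε τ₀ : ℝ} {n : ℕ} (hs₀ : 0 < s₀) (hFm : 0 ≤ Fm) (hK : 0 ≤ K)
    (hn : 1 ≤ n) (hε : 0 < ε) (hτ₀ : τ₀ = min s₀ (min (s₀ / (3 * Fm + 1)) (Real.sqrt (s₀ / (K + 1)))))
    (h : n * ε ≤ τ₀) :
    (n : ℝ) * ε ≤ s₀ ∧ (2 * n + 1) * (ε / 2 * Fm) ≤ s₀ ∧ ε / 2 * K * ε * (n : ℝ) ^ 2 ≤ s₀ := by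
  have hn1 : (1 : ℝ) ≤ n := by exact_mod_cast hn
  have hτs : (n : ℝ) * ε ≤ s₀ := h.trans (by rw [hτ₀]; exact min_le_left _ _)
  have hτF : (n : ℝ) * ε ≤ s₀ / (3 * Fm + 1) := h.trans (by rw [hτ₀]; exact (min_le_right _ _).trans (min_le_left _ _))
  have hτK : (n : ℝ) * ε ≤ Real.sqrt (s₀ / (K + 1)) := h.trans (by rw [hτ₀]; exact (min_le_right _ _).trans (min_le_right _ _))
  refine ⟨hτs, ?_, ?_⟩
  · have h1 : (3 * Fm + 1) * (n * ε) ≤ s₀ := by rwa [← le_div_iff₀' (by positivity)]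
    have h2 : (2 * (n : ℝ) + 1) * (ε / 2 * Fm) ≤ 3 * Fm * (n * ε) / 2 := by nlinarith [mul_nonneg (mul_nonneg (by positivity : (0:ℝ) ≤ n) hε.le) hFm]
    nlinarith [mul_nonneg (mul_nonneg (by positivity : (0:ℝ) ≤ n) hε.le) hFm, hε]
  · have hτ0 : 0 ≤ (n : ℝ) * ε := by positivity
    have h1 : ((n : ℝ) * ε) ^ 2 ≤ s₀ / (K + 1) := by
      calc ((n : ℝ) * ε) ^ 2 ≤ (Real.sqrt (s₀ / (K + 1))) ^ 2 := pow_le_pow_left₀ hτ0 hτK 2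
        _ = s₀ / (K + 1) := Real.sq_sqrt (by positivity)
    have h2 : (K + 1) * ((n : ℝ) * ε) ^ 2 ≤ s₀ := by rwa [← le_div_iff₀' (by positivity)]
    nlinarith [sq_nonneg ((n : ℝ) * ε), hK]

/-- **THE ENGINE'S HMC IN TRAJECTORY-LENGTH FORM.**  For a measurable force field `F` on `SU(N)^links`
bounded by `F_max` per link and `K_F`-Lipschitz in the matrix sup norm, and a measurable action bounded
by `s`: there is `τ₀ > 0` (depending on the coordinates, `F_max`, `K_F` only) such that for EVERY
`n ≥ 1` and `ε > 0` with trajectory length `nε ≤ τ₀`, the engine's `n`-step leapfrog HMC with half kick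
`−(ε/2)·F` converges to `Z_S⁻¹e^{−S}·Haar^{⊗links}` from every initial law geometrically in total
variation (the exponent `k` and the rate may depend on `n, ε`). -/
theorem engine_sunLeapfrogHMCN_uniformlyErgodic_of_trajLength (hF : Measurable F) (hF0 : 0 ≤ Fmax)
    (hFb : ∀ U l, ‖F U l‖ ≤ Fmax) (hKF0 : 0 ≤ KF) (hFK : ∀ U U', ‖F U - F U'‖ ≤ KF * ‖coeConfig U - coeConfig U'‖)
    (hS : Measurable S) (hs : ∀ u, |S u| ≤ s) :
    ∃ τ₀ : ℝ, 0 < τ₀ ∧ ∀ (nstep : ℕ) (ε : ℝ) (hn : 1 ≤ nstep) (hε : 0 < ε), nstep * ε ≤ τ₀ →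
      ∃ k : ℕ, ∃ δ : ℝ, 0 < δ ∧ δ ≤ 1 ∧ ∀ (μ₀ : Measure (L → Matrix.specialUnitaryGroup (Fin N) ℂ))
        [IsProbabilityMeasure μ₀] (t : ℕ) (A : Set (L → Matrix.specialUnitaryGroup (Fin N) ℂ)),
        |((fun m : Measure (L → Matrix.specialUnitaryGroup (Fin N) ℂ) =>
              m.bind (sunLeapfrogHMCN (sunCoordι N) (sunCoordι_skew N) ε (Measure.addHaar : Measure (SUNCoords N))
                (sunKinetic N) (measurable_halfKick_sun N hF ε) S nstep))^[t] μ₀).real A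
            - (gibbsProbability (Measure.pi fun _ : L => haarProbability (Matrix.specialUnitaryGroup (Fin N) ℂ))
                (fun u => Real.exp (-S u))).real A| ≤ (1 - δ) ^ (t / (k + 1)) := by
  set s₀ := sunShortTrajThreshold (sunCoordι N) (sunCoordι_injective N) with hs₀
  have hs₀0 : 0 < s₀ := sunShortTrajThreshold_pos _ _
  refine ⟨min s₀ (min (s₀ / (3 * Fmax + 1)) (Real.sqrt (s₀ / (KF + 1)))),
    lt_min hs₀0 (lt_min (by positivity) (Real.sqrt_pos.2 (by positivity))), fun nstep ε hn hε hτ => ?_⟩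
  obtain ⟨h1, h2, h3⟩ := trajLength_threshold_arith hs₀0 hF0 hKF0 hn hε rfl hτ
  refine engine_sunLeapfrogHMCN_uniformlyErgodic N hε hn (measurable_halfKick_sun N hF ε) (b := ε / 2 * Fmax)
    (Kg := ε / 2 * KF) (by positivity) (fun U l => ?_) (by positivity) (fun U U' => ?_) hS hs h1 h2 h3
  · rw [Pi.smul_apply, norm_smul, Real.norm_eq_abs, abs_neg, abs_of_pos (by positivity)]
    exact mul_le_mul_of_nonneg_left (hFb U l) (by positivity)
  · have hsub : (-(ε / 2)) • F U - (-(ε / 2)) • F U' = (-(ε / 2)) • (F U - F U') := by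
      funext l; simp only [Pi.sub_apply, Pi.smul_apply, smul_sub]
    rw [hsub, norm_smul, Real.norm_eq_abs, abs_neg, abs_of_pos (by positivity), mul_assoc]
    exact mul_le_mul_of_nonneg_left (hFK U U') (by positivity)

end Force

end Summit.Ventures.LatticeQCDFlow.Exactness
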